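import Mathlib
import Literature.Combinatorics.SimpleGraph.LasserreStableBound
import HarnessLib

/-!
# Kunisky–Yu 2022: degree-4 SOS cannot certify `ω(Paley_p) ≤ p^{1/3}` — named fact

Topic `Literature/Combinatorics/SimpleGraph`, over the tree's Lasserre bound
`Literature.Combinatorics.SimpleGraph.lasserreStableBound` (Laurent's `las⁽ᵗ⁾`, program (22)).
ONE NAMED FACT (D-0014, statement only, `def … : Prop`) and the definition of the Paley graph,
requested by the grounding of route `Summit.PneNP.PneNP.Theses.RamseyUncertifiable` (the level-`2`
rung of crux `PaleySosRung`, stmt-PneNP-9817, whose inline Paley graph is `paleyGraph p` by `rfl`).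

## What is printed

D. Kunisky, X. Yu, *A degree 4 sum-of-squares lower bound for the clique number of the Paley
graph* [KuniskyYu2022] (arXiv:2211.02713, read §1.3, §2.2). **Definition 2.3**: for a prime power
`q ≡ 1 (mod 4)` the Paley graph `G_q` has vertex set `𝔽_q` and edges `{a, b}` with
`a − b ∈ (𝔽_q^×)²`. **Program (8)/(13)**: `SOS_{2d}(G)` = `max Σ_i Ẽ[x_i]` over degree-`2d`
pseudoexpectations with `Ẽ[1] = 1`, `Ẽ[(x_i² − x_i)p] = 0`, `Ẽ[x_i x_j p] = 0` for non-adjacent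
`i ≠ j`, `Ẽ[p²] ≥ 0`; equivalently ((13), `2d = 4`) a positive semidefinite pseudomoment matrix `M`
indexed by subsets of size `≤ 2` whose entry `M_{S,T}` depends only on `S ∪ T`, vanishes when
`S ∪ T` is not a clique of `G`, `M_{∅,∅} = 1`, objective `Σ_i M_{∅,{i}}`. **Theorem 1.2**: "There
is a constant `c > 0` such that the value of the degree 4 SOS relaxation of the clique number
`SOS₄(G)`, as defined in Section 2.2.1, evaluated with `G_p` the Paley graph on `p` vertices for `p`
any prime number with `p ≡ 1 (mod 4)`, satisfies `SOS₄(G_p) ≥ c p^{1/3}`." Context (their (17)–(18)):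
`SOS₂(G_q) = ϑ(Ḡ_q) = √q` by Lovász 1979 (vertex-transitive and self-complementary).

## Rendering (the dictionary `SOS₄(G) = las⁽²⁾(Ḡ)`)

Program (13) is Laurent's level-`2` moment program for the STABLE sets of the complement `Ḡ`
(cliques of `G` = stable sets of `Ḡ`): the pseudomoment matrix is the tree's `momentMatrix 2 y`
(`(I, J) ↦ y_{I ∪ J}`, `|I|, |J| ≤ 2`), `M_{∅,∅} = 1` is `y_∅ = 1`, positivity is
`(momentMatrix 2 y).PosSemidef`, the objective `Σ_i M_{∅,{i}}` is `Σ_v y_{v}`. The one difference in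
the written constraints — (13) asks `y_S = 0` for EVERY non-clique `S` of `G` with `|S| ≤ 4`, the
tree's `IsLasserreFeasible Ḡ 2 y` only for the edges `{u, v}` of `Ḡ` (the non-adjacent pairs of
`G`) — is immaterial: under `M_2(y) ⪰ 0` the pair condition propagates to all non-stable `S` with
`|S| ≤ 4` (Laurent 2006, p. 248; PROVED in tree as
`IsLasserreFeasible.apply_eq_zero_of_not_isIndepSet`), so the two feasible sets coincide and
`SOS₄(G) = lasserreStableBound Ḡ 2` (both are suprema over the same set; the tree does not assert
attainment, which a lower bound does not need). We therefore state Theorem 1.2 for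
`lasserreStableBound (paleyGraph p)ᶜ 2`. The Paley graph is typed on `Fin p` (= `𝔽_p` as a
commutative ring for `p` prime) with `SimpleGraph.fromRel`, which symmetrises and removes the
diagonal: `Adj x y ↔ x ≠ y ∧ (IsSquare (x − y) ∨ IsSquare (y − x))`; for `p ≡ 1 (mod 4)`, `−1` is a
square, so this is Definition 2.3 (a nonzero difference that is a square is a nonzero square).

## Tree search

`lean search 'Paley|paley|IsSquare.*fromRel'`: no Paley graph in Mathlib/Literature; the
Lasserre hierarchy is `LasserreStableBound.lean` / `LasserreLevelOne.lean`
(`lasserreStableBound_one_eq_lovaszTheta`). No SOS lower bound for any explicit graph family is in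
the tree.

## References

* [KuniskyYu2022] D. Kunisky, X. Yu, arXiv:2211.02713 (2022): Def. 2.1, (8), (13), Def. 2.3,
  Prop. 2.6, (17)–(18), Theorem 1.2 (p. 4 of the arXiv version).
* [Laurent2006] M. Laurent, program (22) and the propagation remark, p. 248 (as cited in
  `LasserreStableBound.lean`).
-/

noncomputable section

namespace Literature.Combinatorics.SimpleGraph

/-- The **Paley graph** on `Fin p` (`= 𝔽_p` for `p` prime): `x ~ y` iff `x ≠ y` and `x − y` (or
`y − x`) is a square mod `p` (Kunisky–Yu 2022, Def. 2.3: edges `{a,b}` with `a − b ∈ (𝔽_q^×)²`; for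
`p ≡ 1 (mod 4)` the relation is already symmetric). Literally the inline graph of route item
`Summit.PneNP.PneNP.Theses.RamseyUncertifiable.PaleySosRung`. [cite: KuniskyYu2022, Definition 2.3] -/
def paleyGraph (p : ℕ) : _root_.SimpleGraph (Fin p) :=
  _root_.SimpleGraph.fromRel fun x y : Fin p => IsSquare (x - y)

/-- `paleyGraph p` is the route's inline term. [folklore] -/
theorem paleyGraph_eq_fromRel (p : ℕ) :
    paleyGraph p = _root_.SimpleGraph.fromRel fun x y : Fin p => IsSquare (x - y) := rfl

/-- Adjacency in the Paley graph. [cite: KuniskyYu2022, Definition 2.3] -/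
theorem paleyGraph_adj (p : ℕ) (x y : Fin p) :
    (paleyGraph p).Adj x y ↔ x ≠ y ∧ (IsSquare (x - y) ∨ IsSquare (y - x)) := by
  simp [paleyGraph, _root_.SimpleGraph.fromRel_adj]

/-- **Kunisky–Yu 2022, Theorem 1.2** (as printed: "There is a constant `c > 0` such that the value
of the degree 4 SOS relaxation of the clique number `SOS₄(G)` … evaluated with `G_p` the Paley graph
on `p` vertices for `p` any prime number with `p ≡ 1 (mod 4)`, satisfies `SOS₄(G_p) ≥ c p^{1/3}`"),
rendered through the dictionary `SOS₄(G) = las⁽²⁾(Ḡ)` of the module docstring as a lower bound on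
the tree's level-`2` Lasserre stable-set bound of the COMPLEMENT of the Paley graph. The level-`2`
rung of `Summit.PneNP.PneNP.Theses.RamseyUncertifiable.PaleySosRung` (stmt-PneNP-9817) follows
with `η = 1/3` once `las⁽ᵗ⁾` is transported along the self-complementarity `P_p ≅ P̄_p`
(`x ↦ g x`, `g` a non-square), which is NOT asserted here. [cite: KuniskyYu2022, Theorem 1.2] -/
def kuniskyYu2022_theorem_1_2 : Prop :=
  ∃ c : ℝ, 0 < c ∧ ∀ p : ℕ, p.Prime → p % 4 = 1 →
    c * (p : ℝ) ^ ((1 : ℝ) / 3) ≤ lasserreStableBound (paleyGraph p)ᶜ 2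

end Literature.Combinatorics.SimpleGraph

end
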